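import Summits.CriticalPhenomena.PercolationContinuityZ3.Theorems.FK.InfiniteVolumeDLRInsertionTolerance
import Summits.CriticalPhenomena.PercolationContinuityZ3.Theorems.FK.InfiniteVolumeDLRInvariantUniqueness
import Summits.CriticalPhenomena.PercolationContinuityZ3.Theorems.FK.InfiniteVolumeDLRLocalLimit
import HarnessLib

/-!
# FK-continuity transplant, FO-10 (infinite-volume structure): Grimmett 2006, Thm. (4.33)(c) in full and
# Thm. (4.31) ∘ (4.33) — translation-invariant DLR random-cluster measures and translation-invariant local limits of
# finite-volume random-cluster measures have at most one infinite cluster, and such local limits ARE DLR random-cluster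
# measures, every `q > 0` (no ergodicity, no FKG)

Registered R103 (cell INBOX l.7022, 2026-08-24); registry row FO-10b-g412; label DRE-B′ (coordinator fk-4 g216).
Cell `fk-continuity` (bschramm), FO-10b lineage; support file for the FK-continuity transplant
(`--supports stmt-CriticalPhenomena-4575`); builds on p205010 (kernel theorem, internal audit signed; external
expert review pending). CONDITIONAL cell (FH AND TP_FK open at the same `p` for `q > 1`; K1); the transplant is a
typed reduction, not a proof of FK continuity — this file is UNCONDITIONAL infinite-volume structure for general `d`;
no defs, no named facts, no sorries, standard axioms; NOT a binder discharge, NOT `_r4`; `_r3` « 2 / 0 ☑ »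
unchanged, n_open = 2.

## What this file proves (Grimmett 2006, §4.4, pp. 81–86)

Grimmett, Thm. (4.33): (b) every limit point of finite-volume random-cluster measures has the finite-energy
property; (c) "If `φ ∈ cl co W_{p,q}` is translation-invariant, then `φ` has the 0/1-infinite-cluster property" —
so that Thm. (4.31) places it in `R_{p,q}`. With Burton–Keane for translation-invariant insertion-tolerant measures
WITHOUT ergodicity (`ae_numInfiniteClusters_le_one_of_shift_invariant`, `InfiniteVolumeDLRInvariantUniqueness.lean`),
the lower finite energy of local limits and the insertion tolerance it yields
(`InfiniteVolumeDLRInsertionTolerance.lean`), and Thm. (4.31) in the local-limit vocabulary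
(`isDLRRandomCluster_of_localLimit`, `InfiniteVolumeDLRLocalLimit.lean`):

* `ae_numInfiniteClusters_le_one_of_le_oneEdge_of_shift_invariant` — a lattice-carried translation-invariant
  probability measure opening every lattice edge, given the rest, with probability at least `c > 0` has almost surely
  at most one infinite cluster;
* **`ae_numInfiniteClusters_le_one_of_localLimit_of_shift_invariant`** — THM (4.33)(b)+(c): every lattice-carried
  TRANSLATION-INVARIANT local limit `P` of finite measures eventually having the one-edge conditional probabilities
  (4.38) at every lattice edge (`0 < p ≤ 1`, every `q > 0`) has almost surely at most one infinite open cluster;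
* **`IsDLRRandomCluster.ae_numInfiniteClusters_le_one_of_shift_invariant`** — THM (4.33)(c) FOR `R_{p,q}`: every
  lattice-carried translation-invariant DLR random-cluster measure (`0 < p ≤ 1`, every `q > 0`) has almost surely at
  most one infinite open cluster — supersedes the tail-trivial statement
  `IsDLRRandomCluster.ae_numInfiniteClusters_le_one_of_isTailTrivial` of `InfiniteVolumeDLRUniqueCluster.lean`
  (`q ≥ 1`, `p < 1`, via the FKG sandwich);
* **`isDLRRandomCluster_of_localLimit_of_shift_invariant`** — THM (4.31) ∘ (4.33): a translation-invariant
  probability measure which is the local limit of lattice-carried finite measures `μ_n` eventually having (4.38) at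
  every lattice edge IS a DLR random-cluster measure, `P ∈ R_{p,q}` (`0 < p ≤ 1`, every `q > 0`; the `huniq` of
  `isDLRRandomCluster_of_localLimit` discharged by Burton–Keane);
* **`isDLRRandomCluster_of_tendsto_rcCondLaw_of_shift_invariant`** — the same for `W_{p,q}` proper: every
  translation-invariant local limit of finite-volume random-cluster measures `φ^{ξ_n}_{Λ_n,p,q}` with lattice boundary
  conditions and regions eventually containing every lattice edge lies in `R_{p,q}`. Together with a
  translation-invariant limit point (Thm. (4.33)(a), Cesàro averages — not in this file) this is Grimmett's proof of
  `R_{p,q} ≠ ∅` (Thm. (4.34)(a)) for every `p ∈ (0,1]`, `q > 0`.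

## References

* G. Grimmett, *The Random-Cluster Model*, Springer 2006: Thm. (4.31) (p. 81), Thm. (4.33)(b)(c) and footnote 6
  (p. 82), Thm. (4.34)(a), Prop. (4.37)(a), proof of Thm. (4.31) (pp. 83–86). [Grimmett2006]
* R. M. Burton, M. Keane, *Density and uniqueness in percolation*, Comm. Math. Phys. 121 (1989) 501–505. [BurtonKeane1989]
-/

noncomputable section

open MeasureTheory Filter Set

open scoped Topology ENNReal

namespace Summit.CriticalPhenomena.PercolationContinuityZ3.Theorems.FK

open Literature.Probability.Percolation Literature.Probability.LatticeModels

variable {d : ℕ}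

section OneEdge

variable {ν : Measure (BondConfig (Site d))} {c : ℝ}

/-- **Burton–Keane from lower one-edge finite energy and translation invariance alone**: a lattice-carried,
translation-invariant probability measure on bond configurations of `ℤ^d` opening every lattice edge, given the rest,
with probability at least `c > 0` has almost surely at most one infinite cluster (no ergodicity hypothesis).
[cite: BurtonKeane1989, Thm. 2; Grimmett2006, Thm. (4.33)(c)] -/
theorem ae_numInfiniteClusters_le_one_of_le_oneEdge_of_shift_invariant [IsProbabilityMeasure ν]
    (hlat : ∀ᵐ ω ∂ν, ω ⊆ (zdGraph d).edgeSet)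
    (hshift : ∀ (v : Site d) {S : Set (BondConfig (Site d))}, MeasurableSet S →
      ν (BondConfig.relabel (sym2Equiv (Site.shift v)) ⁻¹' S) = ν S)
    (hc : 0 < c)
    (hE : ∀ ⦃a b : Site d⦄, (zdGraph d).Adj a b → ∀ ⦃H₀ : Set (BondConfig (Site d))⦄, MeasurableSet H₀ →
      c * ν.real ((fun η => η \ {s(a, b)}) ⁻¹' H₀) ≤ ν.real ({ω | s(a, b) ∈ ω} ∩ (fun η => η \ {s(a, b)}) ⁻¹' H₀)) :
    ∀ᵐ ω ∂ν, numInfiniteClusters ω ≤ 1 :=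
  ae_numInfiniteClusters_le_one_of_shift_invariant hlat hshift
    (exists_pos_mul_measureReal_preimage_openEdges_box_le_of_le_oneEdge hc hE)

end OneEdge

section LocalLimit

variable {p q : ℝ} {P : Measure (BondConfig (Site d))} {μ : ℕ → Measure (BondConfig (Site d))}

/-- **Grimmett 2006, Thm. (4.33)(b)+(c), every `q > 0`** — a lattice-carried, TRANSLATION-INVARIANT local limit `P`
(a probability measure) of finite measures `μ_n` which eventually have the one-edge conditional probabilities (4.38)
at every lattice edge (`0 < p ≤ 1`; e.g. finite-volume random-cluster measures with lattice boundary conditions and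
regions exhausting `ℤ^d`, or finite convex combinations / Cesàro averages of translates of such) has almost surely at
most one infinite open cluster: lower finite energy of the limit ⇒ insertion tolerance ⇒ Burton–Keane (no ergodicity).
[cite: Grimmett2006, Thm. (4.33)(b)(c) (p. 82); BurtonKeane1989, Thm. 2] -/
theorem ae_numInfiniteClusters_le_one_of_localLimit_of_shift_invariant [IsProbabilityMeasure P]
    [∀ n, IsFiniteMeasure (μ n)]
    (hp : p ∈ Set.Ioc (0 : ℝ) 1) (hq : 0 < q) (hlatP : ∀ᵐ ω ∂P, ω ⊆ (zdGraph d).edgeSet)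
    (hconv : ∀ A : Set (BondConfig (Site d)), IsLocalEvent A → Tendsto (fun n => μ n A) atTop (𝓝 (P A)))
    (hE : ∀ ⦃x y : Site d⦄, (zdGraph d).Adj x y → ∀ᶠ n in atTop, ∀ ⦃H₀ : Set (BondConfig (Site d))⦄,
      MeasurableSet H₀ →
      (μ n).real ({ω | s(x, y) ∈ ω} ∩ (fun η => η \ {s(x, y)}) ⁻¹' H₀) =
        p * (μ n).real ((fun η => η \ {s(x, y)}) ⁻¹' (H₀ ∩ openConn x y)) +
          p / (p + q * (1 - p)) * (μ n).real ((fun η => η \ {s(x, y)}) ⁻¹' (H₀ ∩ (openConn x y)ᶜ)))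
    (hshift : ∀ (v : Site d) {S : Set (BondConfig (Site d))}, MeasurableSet S →
      P (BondConfig.relabel (sym2Equiv (Site.shift v)) ⁻¹' S) = P S) :
    ∀ᵐ ω ∂P, numInfiniteClusters ω ≤ 1 := by
  have hc := min_energy_pos hp hq
  refine ae_numInfiniteClusters_le_one_of_le_oneEdge_of_shift_invariant hlatP hshift hc fun x y hxy H₀ hH₀ => ?_
  have hloc : ∀ ⦃A : Set (BondConfig (Site d))⦄, IsLocalEvent A →
      min p (p / (p + q * (1 - p))) * P.real ((fun η => η \ {s(x, y)}) ⁻¹' A) ≤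
        P.real ({ω | s(x, y) ∈ ω} ∩ (fun η => η \ {s(x, y)}) ⁻¹' A) := fun A hA =>
    le_measureReal_setOf_mem_inter_preimage_of_localLimit_of_isLocalEvent (P := P) (μ := μ) hconv (hE hxy) hA
  exact le_measureReal_setOf_mem_inter_preimage_of_forall_isLocalEvent hc.le hloc hH₀

variable (d) in
/-- **Grimmett 2006, Thm. (4.31) ∘ Thm. (4.33)(b)(c) — translation-invariant local limits are DLR random-cluster
measures, every `q > 0`** (`0 < p ≤ 1`, general `d`): let `μ_n` be finite measures on `Ω = {0,1}^{pairs of ℤ^d}`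
carried by lattice configurations, converging to the probability measure `P` on every local event, such that for every
lattice edge `e`, EVENTUALLY `μ_n` has the one-edge conditional probabilities (4.38) at `e`. If `P` is invariant under
the translations of `ℤ^d`, then `P ∈ R_{p,q}` (`IsDLRRandomCluster d p q P`): the 0/1-infinite-cluster hypothesis of
Thm. (4.31) holds by finite energy of the limit (Thm. (4.33)(b)) and Burton–Keane without ergodicity; `P` is
lattice-carried as a local limit of lattice-carried measures.
[cite: Grimmett2006, Thm. (4.31), Thm. (4.33)(b)(c) (pp. 81–86); BurtonKeane1989, Thm. 2] -/
theorem isDLRRandomCluster_of_localLimit_of_shift_invariant [IsProbabilityMeasure P] [∀ n, IsFiniteMeasure (μ n)]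
    (hp : p ∈ Set.Ioc (0 : ℝ) 1) (hq : 0 < q)
    (hlat : ∀ n, ∀ᵐ ω ∂(μ n), ω ⊆ (zdGraph d).edgeSet)
    (hconv : ∀ A : Set (BondConfig (Site d)), IsLocalEvent A → Tendsto (fun n => μ n A) atTop (𝓝 (P A)))
    (hE : ∀ ⦃x y : Site d⦄, (zdGraph d).Adj x y → ∀ᶠ n in atTop, ∀ ⦃H₀ : Set (BondConfig (Site d))⦄,
      MeasurableSet H₀ →
      (μ n).real ({ω | s(x, y) ∈ ω} ∩ (fun η => η \ {s(x, y)}) ⁻¹' H₀) =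
        p * (μ n).real ((fun η => η \ {s(x, y)}) ⁻¹' (H₀ ∩ openConn x y)) +
          p / (p + q * (1 - p)) * (μ n).real ((fun η => η \ {s(x, y)}) ⁻¹' (H₀ ∩ (openConn x y)ᶜ)))
    (hshift : ∀ (v : Site d) {S : Set (BondConfig (Site d))}, MeasurableSet S →
      P (BondConfig.relabel (sym2Equiv (Site.shift v)) ⁻¹' S) = P S) :
    IsDLRRandomCluster d p q P := by
  -- the local limit of lattice-carried measures is lattice-carried
  have hlatP : ∀ᵐ ω ∂P, ω ⊆ (zdGraph d).edgeSet := by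
    have h0 : ∀ e ∉ (zdGraph d).edgeSet, P {ω : BondConfig (Site d) | e ∈ ω} = 0 := by
      intro e he
      have hn : ∀ n, μ n {ω : BondConfig (Site d) | e ∈ ω} = 0 := fun n =>
        measure_mono_null (fun ω (hω : e ∈ ω) (h : ω ⊆ (zdGraph d).edgeSet) => he (h hω)) (ae_iff.1 (hlat n))
      have ht := hconv _ (isLocalEvent_setOf_mem e)
      simp only [hn] at ht
      exact tendsto_nhds_unique ht tendsto_const_nhds
    have hset : {ω : BondConfig (Site d) | ¬ ω ⊆ (zdGraph d).edgeSet} = ⋃ e ∈ ((zdGraph d).edgeSet)ᶜ, {ω | e ∈ ω} := by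
      ext ω
      simp only [Set.mem_setOf_eq, Set.not_subset, Set.mem_iUnion, Set.mem_compl_iff, exists_prop]
      exact ⟨fun ⟨e, heω, he⟩ => ⟨e, he, heω⟩, fun ⟨e, he, heω⟩ => ⟨e, heω, he⟩⟩
    rw [ae_iff, hset]
    exact (measure_biUnion_null_iff (Set.to_countable _)).2 fun e he => h0 e he
  exact isDLRRandomCluster_of_localLimit d ⟨hp.1.le, hp.2⟩ hq hlat hconv hE
    (ae_numInfiniteClusters_le_one_of_localLimit_of_shift_invariant hp hq hlatP hconv hE hshift)

end LocalLimit

/-! ### Theorem (4.33)(c) for `R_{p,q}` and Theorem (4.31) ∘ (4.33) for `W_{p,q}` -/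

section DLR

variable {p q : ℝ} {P : Measure (BondConfig (Site d))}

/-- **Grimmett 2006, Thm. (4.33)(c) for `R_{p,q}`, every `q > 0`** (`0 < p ≤ 1`): every lattice-carried
TRANSLATION-INVARIANT DLR random-cluster measure has almost surely at most one infinite open cluster (lower finite
energy from Prop. (4.37)(a); Burton–Keane without ergodicity). No FKG, sandwich, tail-triviality or ergodicity input.
[cite: Grimmett2006, Thm. (4.33)(c) and the remark after (4.36) (p. 82), Prop. (4.37)(a); BurtonKeane1989, Thm. 2] -/
theorem IsDLRRandomCluster.ae_numInfiniteClusters_le_one_of_shift_invariant (hP : IsDLRRandomCluster d p q P)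
    (hp : p ∈ Set.Ioc (0 : ℝ) 1) (hq : 0 < q) (hlat : ∀ᵐ ω ∂P, ω ⊆ (zdGraph d).edgeSet)
    (hshift : ∀ (v : Site d) {S : Set (BondConfig (Site d))}, MeasurableSet S →
      P (BondConfig.relabel (sym2Equiv (Site.shift v)) ⁻¹' S) = P S) :
    ∀ᵐ ω ∂P, numInfiniteClusters ω ≤ 1 := by
  haveI := hP.isProbabilityMeasure
  exact ae_numInfiniteClusters_le_one_of_le_oneEdge_of_shift_invariant hlat hshift (min_energy_pos hp hq)
    fun x y hxy H₀ hH₀ => le_measureReal_setOf_mem_inter_preimage_of_oneEdge P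
      (fun H hH => hP.real_edgeOpen_inter_preimage_eq ⟨hp.1.le, hp.2⟩ hq hxy hH) hH₀

variable (d) in
/-- **Grimmett 2006, Thm. (4.31) ∘ Thm. (4.33)(b)(c) for the limit points of finite-volume random-cluster measures
with arbitrary lattice boundary conditions** (`W_{p,q}` proper; general `d`, `0 < p ≤ 1`, every `q > 0`): let `Λ_n`
be finite regions eventually containing every lattice edge and `ξ_n ⊆ 𝔼^d` boundary conditions; if
`φ^{ξ_n}_{Λ_n,p,q}` (`rcCondLaw p q (Λ n) (ξ n)`) converges to the probability measure `P` on every local event and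
`P` is invariant under the translations of `ℤ^d`, then `P ∈ R_{p,q}`.
[cite: Grimmett2006, Def. (4.26) (W_{p,q}), Thm. (4.31), Thm. (4.33)(b)(c), Thm. (4.34)(a); BurtonKeane1989, Thm. 2] -/
theorem isDLRRandomCluster_of_tendsto_rcCondLaw_of_shift_invariant [IsProbabilityMeasure P]
    (hp : p ∈ Set.Ioc (0 : ℝ) 1) (hq : 0 < q) {Λ : ℕ → Finset (Site d)} {ξ : ℕ → BondConfig (Site d)}
    (hξ : ∀ n, ξ n ⊆ (zdGraph d).edgeSet)
    (hΛ : ∀ ⦃x y : Site d⦄, (zdGraph d).Adj x y → ∀ᶠ n in atTop, s(x, y) ∈ edgesIn (zdGraph d) (Λ n))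
    (hconv : ∀ A : Set (BondConfig (Site d)), IsLocalEvent A →
      Tendsto (fun n => rcCondLaw p q (Λ n) (ξ n) A) atTop (𝓝 (P A)))
    (hshift : ∀ (v : Site d) {S : Set (BondConfig (Site d))}, MeasurableSet S →
      P (BondConfig.relabel (sym2Equiv (Site.shift v)) ⁻¹' S) = P S) :
    IsDLRRandomCluster d p q P := by
  have hp' : p ∈ Set.Icc (0 : ℝ) 1 := ⟨hp.1.le, hp.2⟩
  haveI : ∀ n, IsFiniteMeasure (rcCondLaw p q (Λ n) (ξ n)) := fun n => by
    haveI := isProbabilityMeasure_rcCondLaw hp' hq (Λ n) (ξ n)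
    infer_instance
  exact isDLRRandomCluster_of_localLimit_of_shift_invariant d (μ := fun n => rcCondLaw p q (Λ n) (ξ n)) hp hq
    (fun n => rcCondLaw_ae_subset_edgeSet hp' hq (Λ n) (hξ n)) hconv
    (fun x y hxy => (hΛ hxy).mono fun n hn H₀ hH₀ =>
      rcCondLaw_real_edgeOpen_inter_preimage_eq hp' hq (Λ n) (ξ n) hn hH₀)
    hshift

end DLR

end Summit.CriticalPhenomena.PercolationContinuityZ3.Theorems.FK

end
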